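import Mathlib
import Summits.QuantumFields.YangMills.Theorems.BalabanUVNodesN15FirstOrderDefect
import Summits.QuantumFields.YangMills.Theorems.BalabanUVNodesN15CoefficientCommutator
import HarnessLib

/-!
# Route «BalabanUVNodes» (cluster K4 «SpineRates»), Track-A DAG node N15 = spine estimate NE2, BACKGROUND LAYER — FIRST MISSING
# ESTIMATE, part 14: 𝔤-VALUED FIELDS AS SCALAR FIELDS ON THE PRODUCT CARRIER `X × ι` — product block-line data (so that g0's files
# 1∕2∕4∕11 apply BY NAME), the MATRIX multiplication operator `(M_C f)(x, i) = Σ_j C(x)_{ij} f(x, j)`, its exact η-defect and diagonal block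
# majorant (max-row-sum fit), its commutator with the adjoint lattice derivative, and THE FIRST-ORDER SANDWICH FOR MATRIX COEFFICIENTS
# (the term `Σ_b i[A′(b), (D^η_U λ)(b)]` of [B9] (3.52): `V = M_C ∘ ∇`)

Cell `pub-ymgap`, seat `pub-ymgap-dag-n15-b` (generation g3; FIRST-MISSING-ESTIMATE, HUMAN RULING D-0062; chair R424 venue; ROSTER-D0062
l.26).  `bears_on: R4∕N15`.  Filed `--supports stmt-QuantumFields-19351`.  Completes residue (i) of `HOME/HANDOFF-dag-n15-b.md` §g2.3 (parts
13a–c: `…N15ExpLetters`, `…N15MatrixSpecies`, `…N15MatrixCoefficient` = the ZEROTH-order matrix species) with the FIRST-order one: g0 file 4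
`BalabanUVNodesN15FirstOrderDefect.hasMaj_comp_idef_firstOrder_comp` (scalar coefficient `M_a ∘ ∇`) for MATRIX coefficients.

WHY.  The main term of the print's `V′₁(A)` ([Balaban1985BackgroundPropagators] (3.52) p. 400, verbatim, first-hand: *«V′₁(A)λ(x) =
Σ_{b∈st(x)} i[A′(b), (D^η_U λ)(b)] + i[(D^{η*}_U A)(x), λ(x)] + Σ_{b∈st(x)} F′_{1,k}(i ad_{A′(b)}) λ(b₊)»*) is `Σ_b ad_{A′(b)} ∘ ∇_b`: a MATRIX
coefficient times a lattice derivative of a `𝔤`-valued field.  The scalar lineage (files 1∕2∕4∕11) proves the η-defect bound for `M_a ∘ ∇`, `a`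
real.  THE DEVICE here: a `𝔤`-valued field `λ : X → ℝ^ι` IS a scalar field on `X × ι`, lattice derivatives act on the `X` factor only, and
block-line data lift to the product with the spectator `ι` (`prodLine`) — so files 1∕2∕4∕11 apply on `X × ι` BY NAME, and the ONE new object is
the matrix multiplication operator `mmulOp C` (block diagonal in `X`, a genuine matrix in `ι`), whose η-defect is multiplication by the fit
error `C′ − C∘π` with DIAGONAL block majorant of size the blockwise max-row-sum of the fit error.  THE PRINT USED (SHAPES only): (3.35) p. 396,
(3.42) p. 397 (entries 2, 3), (3.52) p. 400; [B6] (2.54) p. 233.  Nothing of [B9] asserted.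

CONTENTS (all [folklore]: linear algebra and finite sups over hypothesis-shaped data; files 1∕2∕4∕11, `T4EtaRateDefect`, `T4EtaRateCoeffDefect` BY NAME).
* §1 `liftMap`, `liftEquiv`, `liftBlk`, `prodLine D ι : LineData (X × ι) (X′ × ι)` (file 1's block-line data with spectator `ι`).
* §2 `mmulOp C` on the sharp block norms `BlockNorm.ofBlocks g (liftBlk blk ι)` (= block sup of the `ℓ^∞(ι)` norm): `idef_mmulOp_apply` ∕ `_eq`
  (EXACT `𝔇(M_{C′}, M_C) = M_{C′ − C∘π} ∘ pull`), `loc_fine_mmul_pull_le`, `hasMaj_idef_mmulOp` (`diagK o` from the MAX-ROW-SUM fit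
  `Σ_j |C′(x′)_{ij} − C(πx′)_{ij}| ≤ o(blk(πx′))`), `hasMaj_mmulOp`, `hasMaj_idef_mmulOp_comp_transfer`, `hasMaj_comp_idef_mmulOp_comp` (zeroth order).
* §3 `mmulOp_comp_bdiffN` (EXACT commutator `M_C ∘ ∇* = ∇* ∘ M_C + M_{η⁻¹(C − C∘s⁻¹)} ∘ pull s⁻¹`), `hasMaj_comp_mmulOp_bdiffN` (the composite left
  factor's adjoint-derivative entry from `T′`'s OWN (3.42)₃ entry, `T′ ≤ N_T`, row letters `α` ∕ `G` ((3.35) shapes) and a shift majorant — file 11 for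
  matrices), `hasMaj_pull_liftEquiv_symm` (the shift majorant = file 11's `hasMaj_pull_symm` on `prodLine D ι` BY NAME).
* §4 **`hasMaj_comp_idef_firstOrderM_comp`** — THE SANDWICHED FIRST-ORDER DEFECT FOR MATRIX COEFFICIENTS: `T′ ∘ 𝔇(M_{C′}∇′_{η′}, M_C∇_η) ∘ A ≤
  (m₃A₁c_η + m_Tε A₁C)·e^{−ρd(y,y′)}·w(y′)` from (d1) `∇_η∘A ≤ A₁e^{−(ρ+σ)d}`, (d2) the adjoint-derivative entry `N₃` of `T′∘M_{C′}` (§3), (d3) the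
  max-row-sum fit `o ≤ εw`, (d4) `|η′|(M−1) ≤ c_η w` — file 4's statement with `mulOp a` ↦ `mmulOp C`; proof = Leibniz + file 4's `hasMaj_derivPiece`
  ON `X × ι` BY NAME + §2's coefficient piece.

HONEST FRAMING ∕ LIMITS.  MECHANISM over hypothesis-SHAPED letters: `𝔤 ≅ ℝ^ι` in a basis with the `ℓ^∞` norm and matrix coefficients measured by
max row sums; the operator-norm letters of 13a∕13b for `C = Φ(η, ad_A)` give these row letters only up to the basis' norm-equivalence constants (a
dictionary NOT typed here); derivatives act on the lattice factor only (no connection `U` in the model derivative: `U ≡ 1` shifts); zero-range ∕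
diagonal kernels for coefficient defects.  NE2⁺ NOT PRINTED, NOT proved; count-neutral (typed 28∕28; nothing discharged); one finite T⁴ at fixed ε —
NOT infinite volume, NOT OS on ℝ⁴, NOT a mass gap, NOT Clay.
-/

noncomputable section

namespace Summit.QuantumFields.YangMills.BalabanUVNodes.N15.MatrixSpecies

open Literature.MathematicalPhysics.QuantumFieldTheory.Balaban1983to89
open Literature.MathematicalPhysics.QuantumFieldTheory.Balaban1983to89.T4EtaRateDefect (idef idef_apply idef_comp SlowWeight
  hasMaj_comp_transfer hasMaj_comp_wrow_source)
open Literature.MathematicalPhysics.QuantumFieldTheory.Balaban1983to89.T4EtaRateCoeffDefect (pull pull_apply diagK diagK_same diagK_ne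
  diagK_nonneg wrow_diagK)
open Literature.MathematicalPhysics.QuantumFieldTheory.Balaban1983to89.B11AxialTransport190 (abs_le_loc_ofBlocks loc_ofBlocks_le)
open B6RandomWalk B11SectG B9SectDWeightedNeumann Finset
open Summit.QuantumFields.YangMills.BalabanUVNodes.N15.DerivDefect

/-! ## §1 The product carrier: lifted maps, permutations, block maps; product block-line data -/

section Product

variable {X X' S : Type}

/-- A map of the lattice factor acting on the product carrier: `liftMap π ι (x′, i) = (π x′, i)`. [folklore] -/
abbrev liftMap (π : X' → X) (ι : Type) : X' × ι → X × ι := fun p => (π p.1, p.2)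

/-- A block map of the lattice factor read on the product carrier: `liftBlk blk ι (x, i) = blk x` (the component index is a spectator).
[folklore] -/
abbrev liftBlk (blk : X → S) (ι : Type) : X × ι → S := fun p => blk p.1

/-- A permutation of the lattice factor (a unit shift of a torus or of `ℤ^d`) acting on the product carrier. [folklore] -/
def liftEquiv (s : X ≃ X) (ι : Type) : X × ι ≃ X × ι where
  toFun p := (s p.1, p.2)
  invFun p := (s.symm p.1, p.2)
  left_inv p := by simp
  right_inv p := by simp

/-- Unfolding. [folklore] -/
@[simp] theorem liftEquiv_apply (s : X ≃ X) (ι : Type) (p : X × ι) : liftEquiv s ι p = (s p.1, p.2) := rfl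
/-- Unfolding of the inverse. [folklore] -/
@[simp] theorem liftEquiv_symm_apply (s : X ≃ X) (ι : Type) (p : X × ι) : (liftEquiv s ι).symm p = (s.symm p.1, p.2) := rfl

/-- PRODUCT BLOCK-LINE DATA: file 1's `LineData` (block projection, coarse∕fine unit shifts, depth along the line, spacing ratio `M`) lifted
to the product carriers `X × ι`, `X′ × ι` with the component index as a spectator — every axiom is the original one on the first factor.
[cite: King1986, p.664 (pairing convention «x′ ∈ B^n(x)»)] -/
def prodLine (D : LineData X X') (ι : Type) : LineData (X × ι) (X' × ι) where
  M := D.M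
  M_pos := D.M_pos
  π := liftMap D.π ι
  s := liftMap D.s ι
  s' := liftEquiv D.s' ι
  dep p := D.dep p.1
  dep_lt p := D.dep_lt p.1
  π_succ_of_lt p h := Prod.ext (D.π_succ_of_lt p.1 h) rfl
  dep_succ_of_lt p h := D.dep_succ_of_lt p.1 h
  π_succ_of_eq p h := Prod.ext (D.π_succ_of_eq p.1 h) rfl
  dep_succ_of_eq p h := D.dep_succ_of_eq p.1 h
/-- The spacing ratio of the product data is the original one. [folklore] -/
@[simp] theorem prodLine_M (D : LineData X X') (ι : Type) : (prodLine D ι).M = D.M := rfl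

end Product

/-! ## §2 The matrix multiplication operator on the product carrier and its defect calculus -/

section MatrixOp

variable {X X' : Type} {ι : Type} [Fintype ι]

/-- THE MATRIX MULTIPLICATION OPERATOR `(M_C f)(x, i) = Σ_j C(x)_{ij}·f(x, j)` by a matrix-valued coefficient `C : X → Matrix ι ι ℝ` on the
scalar fields of the product carrier — block-diagonal in the lattice factor, a genuine matrix in the components (the shape of `ad_{A(b)}`,
`exp(η ad_{A(b)})`, `F′_{1,k}(ad_{A(b)})` of [B9] (3.50)–(3.52) acting on `𝔤 ≅ ℝ^ι`). [folklore] -/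
def mmulOp (C : X → Matrix ι ι ℝ) : (X × ι → ℝ) →ₗ[ℝ] (X × ι → ℝ) where
  toFun f p := ∑ j, C p.1 p.2 j * f (p.1, j)
  map_add' f f' := funext fun p => by
    simp only [Pi.add_apply, mul_add, Finset.sum_add_distrib]
  map_smul' c f := funext fun p => by
    simp only [Pi.smul_apply, smul_eq_mul, RingHom.id_apply, Finset.mul_sum]
    exact Finset.sum_congr rfl fun j _ => by ring

/-- Pointwise form. [folklore] -/
@[simp] theorem mmulOp_apply (C : X → Matrix ι ι ℝ) (f : X × ι → ℝ) (p : X × ι) :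
    mmulOp C f p = ∑ j, C p.1 p.2 j * f (p.1, j) := rfl

/-- THE EXACT DEFECT FORMULA, pointwise: `(M_{C′}τ − τM_C) f (x′, i) = Σ_j (C′(x′) − C(πx′))_{ij}·f(πx′, j)`. [folklore] -/
theorem idef_mmulOp_apply (π : X' → X) (C' : X' → Matrix ι ι ℝ) (C : X → Matrix ι ι ℝ) (f : X × ι → ℝ) (p : X' × ι) :
    idef (pull (liftMap π ι)) (pull (liftMap π ι)) (mmulOp C') (mmulOp C) f p =
      ∑ j, (C' p.1 - C (π p.1)) p.2 j * f (π p.1, j) := by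
  simp only [idef_apply, Pi.sub_apply, mmulOp_apply, pull_apply, Matrix.sub_apply, sub_mul, Finset.sum_sub_distrib]

/-- THE EXACT DEFECT FORMULA, as operators: `𝔇(M_{C′}, M_C) = M_{C′ − C∘π} ∘ τ`. [folklore] -/
theorem idef_mmulOp_eq (π : X' → X) (C' : X' → Matrix ι ι ℝ) (C : X → Matrix ι ι ℝ) :
    idef (pull (liftMap π ι)) (pull (liftMap π ι)) (mmulOp C') (mmulOp C) =
      mmulOp (fun x' => C' x' - C (π x')) ∘ₗ pull (liftMap π ι) := by
  refine LinearMap.ext fun f => funext fun p => ?_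
  rw [idef_mmulOp_apply]
  rfl

variable [Fintype X] [Fintype X'] {g : B6.Geometry}

omit [Fintype X'] in
/-- THE ONE ESTIMATE.  A fine field `(x′, i) ↦ Σ_j c(x′)_{ij}·μ(πx′, j)` with row sums `Σ_j |c(x′)_{ij}| ≤ o(blk(πx′))` has, on the cube `y`, fine
block sup `≤ o(y)·`(coarse block sup of `μ` on `y`) — and `0` on every other cube than the one where the (localised) coarse input lives. [folklore] -/
theorem loc_fine_mmul_pull_le [Fintype X'] (blk : X → g.Site) (π : X' → X) {c : X' → Matrix ι ι ℝ} {o : g.Site → ℝ}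
    (ho : ∀ y, 0 ≤ o y) (hc : ∀ x' i, ∑ j, |c x' i j| ≤ o (blk (π x'))) {y' : g.Site} {μ : X × ι → ℝ}
    (hμ : (BlockNorm.ofBlocks g (liftBlk blk ι)).IsLoc y' μ) (y : g.Site) :
    (BlockNorm.ofBlocks g (liftBlk (blk ∘ π) ι)).loc y (fun p => ∑ j, c p.1 p.2 j * μ (π p.1, j)) ≤
      diagK o y y' * (BlockNorm.ofBlocks g (liftBlk blk ι)).loc y' μ := by
  classical
  have hμ' : ∀ p : X × ι, blk p.1 ≠ y' → μ p = 0 := hμ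
  have hℓ0 := (BlockNorm.ofBlocks g (liftBlk blk ι)).loc_nonneg y' μ
  by_cases hy : y = y'
  · subst hy
    rw [diagK_same]
    refine loc_ofBlocks_le (liftBlk (blk ∘ π) ι) _ (mul_nonneg (ho y) hℓ0) fun p hp => ?_
    have hx : blk (π p.1) = y := hp
    calc |∑ j, c p.1 p.2 j * μ (π p.1, j)| ≤ ∑ j, |c p.1 p.2 j * μ (π p.1, j)| := Finset.abs_sum_le_sum_abs _ _
      _ = ∑ j, |c p.1 p.2 j| * |μ (π p.1, j)| := Finset.sum_congr rfl fun j _ => abs_mul _ _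
      _ ≤ ∑ j, |c p.1 p.2 j| * (BlockNorm.ofBlocks g (liftBlk blk ι)).loc y μ :=
          Finset.sum_le_sum fun j _ => mul_le_mul_of_nonneg_left
            (abs_le_loc_ofBlocks (liftBlk blk ι) μ (x' := (π p.1, j)) hx) (abs_nonneg _)
      _ = (∑ j, |c p.1 p.2 j|) * (BlockNorm.ofBlocks g (liftBlk blk ι)).loc y μ := by rw [Finset.sum_mul]
      _ ≤ o y * (BlockNorm.ofBlocks g (liftBlk blk ι)).loc y μ := mul_le_mul_of_nonneg_right (hx ▸ hc p.1 p.2) hℓ0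
  · rw [diagK_ne o hy, zero_mul]
    refine loc_ofBlocks_le (liftBlk (blk ∘ π) ι) _ le_rfl fun p hp => ?_
    have hx : blk (π p.1) = y := hp
    have h0 : ∀ j, μ (π p.1, j) = 0 := fun j => hμ' (π p.1, j) (by rw [hx]; exact hy)
    simp [h0]

omit [Fintype X'] in
/-- THE BLOCK MAJORANT OF A MATRIX-COEFFICIENT DEFECT.  From the MAX-ROW-SUM FIT `Σ_j |C′(x′)_{ij} − C(πx′)_{ij}| ≤ o(blk(πx′))` (`o ≥ 0`):
`𝔇(M_{C′}, M_C)` has the diagonal majorant `1_{y=y′}·o(y′)` between the sharp block norms of the product carriers. [folklore] -/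
theorem hasMaj_idef_mmulOp [Fintype X'] (blk : X → g.Site) (π : X' → X) {C' : X' → Matrix ι ι ℝ} {C : X → Matrix ι ι ℝ}
    {o : g.Site → ℝ} (ho : ∀ y, 0 ≤ o y) (hfit : ∀ x' i, ∑ j, |C' x' i j - C (π x') i j| ≤ o (blk (π x'))) :
    HasMaj (BlockNorm.ofBlocks g (liftBlk blk ι)) (BlockNorm.ofBlocks g (liftBlk (blk ∘ π) ι))
      (idef (pull (liftMap π ι)) (pull (liftMap π ι)) (mmulOp C') (mmulOp C)) (diagK o) := by
  intro y' μ hμ y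
  have hfun : idef (pull (liftMap π ι)) (pull (liftMap π ι)) (mmulOp C') (mmulOp C) μ =
      fun p => ∑ j, (C' p.1 - C (π p.1)) p.2 j * μ (π p.1, j) := funext fun p => idef_mmulOp_apply π C' C μ p
  rw [hfun]
  exact loc_fine_mmul_pull_le blk π ho (c := fun x' => C' x' - C (π x')) (fun x' i => by simpa using hfit x' i) hμ y

omit [Fintype X'] in
/-- A matrix multiplication operator with row sums `Σ_j |C(x)_{ij}| ≤ m(blk x)` (`m ≥ 0`) has the diagonal majorant `diagK m`. [folklore] -/
theorem hasMaj_mmulOp (blk : X → g.Site) {C : X → Matrix ι ι ℝ} {m : g.Site → ℝ} (hm : ∀ y, 0 ≤ m y)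
    (hC : ∀ x i, ∑ j, |C x i j| ≤ m (blk x)) :
    HasMaj (BlockNorm.ofBlocks g (liftBlk blk ι)) (BlockNorm.ofBlocks g (liftBlk blk ι)) (mmulOp C) (diagK m) := by
  intro y' μ hμ y
  exact loc_fine_mmul_pull_le blk id hm hC hμ y

variable {F₁ F₃ : Type} [AddCommGroup F₁] [Module ℝ F₁] [AddCommGroup F₃] [Module ℝ F₃] {b₁ : BlockNorm g F₁} {b₃ : BlockNorm g F₃}

/-- THE MATRIX-COEFFICIENT DEFECT INSIDE A COMPOSITE (`T4EtaRateDefect.hasMaj_comp_transfer` BY NAME; `T4EtaRateCoeffDefect.hasMaj_idef_mulOp_comp_transfer`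
for matrices): fit `o ≤ ε·w` (slow weight `w`), coarse factor `T ≤ A₀e^{−(ρ+σ)d}` ⟹ `𝔇(M_{C′}, M_C)·T ≤ εA₀C·e^{−ρd(y,y′)}·w(y′)`. [folklore] -/
theorem hasMaj_idef_mmulOp_comp_transfer (blk : X → g.Site) (π : X' → X) {C' : X' → Matrix ι ι ℝ} {Cc : X → Matrix ι ι ℝ}
    {o w : g.Site → ℝ} {ε ρ σ C A₀ : ℝ} {T : F₁ →ₗ[ℝ] (X × ι → ℝ)}
    (htri : Triangle254 g) (hdiag : ∀ y, g.dist y y = 0) (hρ : 0 ≤ ρ) (hA₀ : 0 ≤ A₀) (hC : 0 ≤ C)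
    (hε : 0 ≤ ε) (hw : ∀ y, 0 ≤ w y) (hsw : SlowWeight g σ C w)
    (ho : ∀ y, 0 ≤ o y) (how : ∀ y, o y ≤ ε * w y) (hfit : ∀ x' i, ∑ j, |C' x' i j - Cc (π x') i j| ≤ o (blk (π x')))
    (hT : HasMaj b₁ (BlockNorm.ofBlocks g (liftBlk blk ι)) T (fun y y' => A₀ * Real.exp (-((ρ + σ) * g.dist y y')))) :
    HasMaj b₁ (BlockNorm.ofBlocks g (liftBlk (blk ∘ π) ι)) (idef (pull (liftMap π ι)) (pull (liftMap π ι)) (mmulOp C') (mmulOp Cc) ∘ₗ T)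
      (fun y y' => ε * A₀ * C * Real.exp (-(ρ * g.dist y y')) * w y') := by
  classical
  have h₁ : HasMaj (BlockNorm.ofBlocks g (liftBlk blk ι)) (BlockNorm.ofBlocks g (liftBlk (blk ∘ π) ι))
      (idef (pull (liftMap π ι)) (pull (liftMap π ι)) (mmulOp C') (mmulOp Cc))
      (fun y y'' => diagK (fun _ : g.Site => ε) y y'' * w y'') := by
    refine (hasMaj_idef_mmulOp blk π ho hfit).mono fun y y'' => ?_
    by_cases hy : y = y''
    · subst hy
      simpa using how y
    · rw [diagK_ne o hy, diagK_ne _ hy, zero_mul]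
  have key := hasMaj_comp_transfer htri hρ hA₀ hC (diagK_nonneg fun _ => hε) hw hsw (wrow_diagK ρ ε hdiag) h₁ hT
  have hκ : (BlockNorm.ofBlocks g (liftBlk blk ι)).κ = 1 := rfl
  simpa only [hκ, one_mul] using key

/-- THE MATRIX COEFFICIENT SANDWICHED (file 4's `hasMaj_comp_idef_zerothOrder_comp` for matrices): `T′ ∘ 𝔇(M_{C′}, M_C) ∘ A ≤
m_T·(ε₀A₀C)·e^{−ρd}·w(y′)`. [folklore] -/
theorem hasMaj_comp_idef_mmulOp_comp (blk : X → g.Site) (π : X' → X) (htri : Triangle254 g) (hdiag : ∀ y, g.dist y y = 0)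
    {ρ σ C ε₀ A₀ m_T : ℝ} (hρ : 0 ≤ ρ) (hA₀ : 0 ≤ A₀) (hC : 0 ≤ C) (hε₀ : 0 ≤ ε₀) {w o₀ : g.Site → ℝ} (hw : ∀ y, 0 ≤ w y)
    (hsw : SlowWeight g σ C w) (ho₀ : ∀ y, 0 ≤ o₀ y) (how₀ : ∀ y, o₀ y ≤ ε₀ * w y)
    {C' : X' → Matrix ι ι ℝ} {Cc : X → Matrix ι ι ℝ} (hfit : ∀ x' i, ∑ j, |C' x' i j - Cc (π x') i j| ≤ o₀ (blk (π x')))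
    {T' : (X' × ι → ℝ) →ₗ[ℝ] F₃} {A : F₁ →ₗ[ℝ] (X × ι → ℝ)} {N_T : g.Site → g.Site → ℝ} (hNT : ∀ a b, 0 ≤ N_T a b)
    (hmT : WRow g ρ N_T m_T) (hT : HasMaj (BlockNorm.ofBlocks g (liftBlk (blk ∘ π) ι)) b₃ T' N_T)
    (hA : HasMaj b₁ (BlockNorm.ofBlocks g (liftBlk blk ι)) A (fun y y' => A₀ * Real.exp (-((ρ + σ) * g.dist y y')))) :
    HasMaj b₁ b₃ (T' ∘ₗ idef (pull (liftMap π ι)) (pull (liftMap π ι)) (mmulOp C') (mmulOp Cc) ∘ₗ A)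
      (fun y y' => m_T * (ε₀ * A₀ * C) * Real.exp (-(ρ * g.dist y y')) * w y') := by
  have hin := hasMaj_idef_mmulOp_comp_transfer (b₁ := b₁) blk π htri hdiag hρ hA₀ hC hε₀ hw hsw ho₀ how₀ hfit hA
  have key := hasMaj_comp_wrow_source htri hρ (mul_nonneg (mul_nonneg hε₀ hA₀) hC) hNT hw hmT hT hin
  have hκ' : (BlockNorm.ofBlocks g (liftBlk (blk ∘ π) ι)).κ = 1 := rfl
  have hop : T' ∘ₗ idef (pull (liftMap π ι)) (pull (liftMap π ι)) (mmulOp C') (mmulOp Cc) ∘ₗ A =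
      T' ∘ₗ (idef (pull (liftMap π ι)) (pull (liftMap π ι)) (mmulOp C') (mmulOp Cc) ∘ₗ A) := rfl
  rw [hop]
  simpa only [hκ', one_mul] using key

end MatrixOp

/-! ## §3 The commutator of a matrix coefficient with the adjoint lattice derivative; the composite's adjoint-derivative entry -/

section Commutator

variable {X : Type} {ι : Type} [Fintype ι]

/-- THE MATRIX COEFFICIENT COMMUTATOR, EXACT (file 11's `mulOp_comp_bdiffN` for matrices; the shift acts on the lattice factor, the matrix on the
components): `M_C ∘ ∇*_η = ∇*_η ∘ M_C + M_{η⁻¹(C − C∘s⁻¹)} ∘ (pull s⁻¹)`. [folklore] -/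
theorem mmulOp_comp_bdiffN (η : ℝ) (s : X ≃ X) (C : X → Matrix ι ι ℝ) :
    mmulOp C ∘ₗ bdiffN η (liftEquiv s ι) =
      bdiffN η (liftEquiv s ι) ∘ₗ mmulOp C + mmulOp (η⁻¹ • (C - C ∘ s.symm)) ∘ₗ pull (liftEquiv s ι).symm := by
  ext g p
  simp only [LinearMap.comp_apply, LinearMap.add_apply, Pi.add_apply, mmulOp_apply, bdiffN_apply, pull_apply, liftEquiv_symm_apply,
    Pi.smul_apply, Pi.sub_apply, Function.comp_apply, Matrix.smul_apply, Matrix.sub_apply, smul_eq_mul]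
  rw [← Finset.sum_sub_distrib, Finset.mul_sum, ← Finset.sum_add_distrib]
  exact Finset.sum_congr rfl fun j _ => by ring

/-- Inside a composite: `(T′∘M_{C′})∘∇′*_{η′} = (T′∘∇′*_{η′})∘M_{C′} + T′∘M_{η′⁻¹(C′ − C′∘s′⁻¹)}∘(pull s′⁻¹)`. [folklore] -/
theorem comp_mmulOp_comp_bdiffN {F : Type} [AddCommGroup F] [Module ℝ F] (T' : (X × ι → ℝ) →ₗ[ℝ] F) (η' : ℝ) (s' : X ≃ X)
    (C' : X → Matrix ι ι ℝ) :
    (T' ∘ₗ mmulOp C') ∘ₗ bdiffN η' (liftEquiv s' ι) =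
      (T' ∘ₗ bdiffN η' (liftEquiv s' ι)) ∘ₗ mmulOp C' +
        T' ∘ₗ (mmulOp (η'⁻¹ • (C' - C' ∘ s'.symm)) ∘ₗ pull (liftEquiv s' ι).symm) := by
  rw [LinearMap.comp_assoc, mmulOp_comp_bdiffN, LinearMap.comp_add, ← LinearMap.comp_assoc]

variable [Fintype X] {g : B6.Geometry} (blk' : X → g.Site)

/-- **THE COMPOSITE's ADJOINT-DERIVATIVE ENTRY FROM PRINTED-SHAPE LETTERS** (file 11's `hasMaj_comp_mulOp_bdiffN` for matrices).  If the fine left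
factor's own adjoint-derivative entry has a majorant `N₃ ≥ 0` (`T′∘∇′*_{η′} ≤ N₃`, SHAPE (3.42)₃), `T′ ≤ N_T` (`N_T ≥ 0`), the matrix coefficient has
row sums `Σ_j |C′(x′)_{ij}| ≤ α` and backward difference quotients `Σ_j |η′⁻¹(C′(x′) − C′(s′⁻¹x′))_{ij}| ≤ G` (SHAPES (3.35)), and the lifted inverse shift
`pull (liftEquiv s′ ι)⁻¹` has a majorant `K_sh ≥ 0`, then `(T′∘M_{C′})∘∇′*_{η′} ≤ α·N₃ + G·(N_T ⋆ K_sh)` — the binder `hS` of §4. [cite: Balaban1985BackgroundPropagators, Thm 3.1 (3.42) p.397 + (3.35) p.396 (shapes)] -/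
theorem hasMaj_comp_mmulOp_bdiffN {F₃ : Type} [AddCommGroup F₃] [Module ℝ F₃] {b₃ : BlockNorm g F₃}
    {T' : (X × ι → ℝ) →ₗ[ℝ] F₃} {η' : ℝ} {s' : X ≃ X} {C' : X → Matrix ι ι ℝ} {N₃ N_T Ksh : g.Site → g.Site → ℝ} {α G : ℝ}
    (hN₃ : ∀ y y', 0 ≤ N₃ y y') (hNT : ∀ y y', 0 ≤ N_T y y') (hα : 0 ≤ α) (hG : 0 ≤ G)
    (hS₀ : HasMaj (BlockNorm.ofBlocks g (liftBlk blk' ι)) b₃ (T' ∘ₗ bdiffN η' (liftEquiv s' ι)) N₃)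
    (hT : HasMaj (BlockNorm.ofBlocks g (liftBlk blk' ι)) b₃ T' N_T)
    (hsh : HasMaj (BlockNorm.ofBlocks g (liftBlk blk' ι)) (BlockNorm.ofBlocks g (liftBlk blk' ι)) (pull (liftEquiv s' ι).symm) Ksh)
    (ha : ∀ x' i, ∑ j, |C' x' i j| ≤ α) (hda : ∀ x' i, ∑ j, |η'⁻¹ * (C' x' i j - C' (s'.symm x') i j)| ≤ G) :
    HasMaj (BlockNorm.ofBlocks g (liftBlk blk' ι)) b₃ ((T' ∘ₗ mmulOp C') ∘ₗ bdiffN η' (liftEquiv s' ι))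
      (fun y y' => α * N₃ y y' + G * ∑ y'', N_T y y'' * Ksh y'' y') := by
  rw [comp_mmulOp_comp_bdiffN]
  have hκ : (BlockNorm.ofBlocks g (liftBlk blk' ι)).κ = 1 := rfl
  -- first piece: (T′∇′*) ∘ M_{C′}
  have h1 : HasMaj (BlockNorm.ofBlocks g (liftBlk blk' ι)) b₃ ((T' ∘ₗ bdiffN η' (liftEquiv s' ι)) ∘ₗ mmulOp C')
      (fun y y' => α * N₃ y y') := by
    have hm := hasMaj_mmulOp (g := g) blk' (m := fun _ => α) (fun _ => hα) (fun x' i => ha x' i)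
    refine (hasMaj_comp hS₀ hm hN₃).mono fun y y' => le_of_eq ?_
    simp only [hκ, one_mul]
    rw [sum_mul_diagK]
    ring
  -- second piece: T′ ∘ M_{∇⁻C′} ∘ shift
  have h2 : HasMaj (BlockNorm.ofBlocks g (liftBlk blk' ι)) b₃
      (T' ∘ₗ (mmulOp (η'⁻¹ • (C' - C' ∘ s'.symm)) ∘ₗ pull (liftEquiv s' ι).symm))
      (fun y y' => G * ∑ y'', N_T y y'' * Ksh y'' y') := by
    have hm : HasMaj (BlockNorm.ofBlocks g (liftBlk blk' ι)) (BlockNorm.ofBlocks g (liftBlk blk' ι))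
        (mmulOp (η'⁻¹ • (C' - C' ∘ s'.symm))) (diagK fun _ => G) :=
      hasMaj_mmulOp (g := g) blk' (fun _ => hG) fun x' i => by
        simpa only [Pi.smul_apply, Pi.sub_apply, Function.comp_apply, Matrix.smul_apply, Matrix.sub_apply, smul_eq_mul] using hda x' i
    have hin := hasMaj_comp hm hsh (diagK_nonneg fun _ => hG)
    have hin' : HasMaj (BlockNorm.ofBlocks g (liftBlk blk' ι)) (BlockNorm.ofBlocks g (liftBlk blk' ι))
        (mmulOp (η'⁻¹ • (C' - C' ∘ s'.symm)) ∘ₗ pull (liftEquiv s' ι).symm) (fun y y' => G * Ksh y y') := by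
      refine hin.mono fun y y' => le_of_eq ?_
      simp only [hκ, one_mul]
      exact sum_diagK_mul _ _ _
    refine (hasMaj_comp hT hin' hNT).mono fun y y' => le_of_eq ?_
    simp only [hκ, one_mul]
    rw [Finset.mul_sum]
    exact Finset.sum_congr rfl fun y'' _ => by ring
  exact h1.add h2

end Commutator

/-! ## §4 The first-order sandwich for matrix coefficients on the product carrier -/

section FirstOrder

variable {X X' : Type} (D : LineData X X') (ι : Type) [Fintype ι]

/-- THE SHIFT MAJORANT ON THE PRODUCT CARRIER: the lifted fine inverse shift `pull (prodLine D ι).s′⁻¹` has file 11's majorant `shiftKernel D blk`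
between the fine block norms (file 11's `hasMaj_pull_symm` applied to `prodLine D ι` BY NAME; the kernel only sees the lattice factor). [folklore] -/
theorem hasMaj_pull_liftEquiv_symm [Fintype X] [Fintype X'] {g : B6.Geometry} (blk : X → g.Site) :
    HasMaj (BlockNorm.ofBlocks g (liftBlk (blk ∘ D.π) ι)) (BlockNorm.ofBlocks g (liftBlk (blk ∘ D.π) ι))
      (pull (liftEquiv D.s' ι).symm) (shiftKernel (prodLine D ι) (liftBlk blk ι)) :=
  hasMaj_pull_symm (prodLine D ι) (liftBlk blk ι)

/-- LEIBNIZ for matrix coefficients: `𝔇(M_{C′}∇′_{η′}, M_C∇_η) = M_{C′} ∘ 𝔇(∇′_{η′}, ∇_η) + 𝔇(M_{C′}, M_C) ∘ ∇_η` on the product carrier. [folklore] -/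
theorem idef_firstOrderM_eq (C' : X' → Matrix ι ι ℝ) (C : X → Matrix ι ι ℝ) (η η' : ℝ) :
    idef (pull (prodLine D ι).π) (pull (prodLine D ι).π) (mmulOp C' ∘ₗ fdiffN η' (prodLine D ι).s') (mmulOp C ∘ₗ fdiffN η (prodLine D ι).s) =
      mmulOp C' ∘ₗ idef (pull (prodLine D ι).π) (pull (prodLine D ι).π) (fdiffN η' (prodLine D ι).s') (fdiffN η (prodLine D ι).s) +
        idef (pull (prodLine D ι).π) (pull (prodLine D ι).π) (mmulOp C') (mmulOp C) ∘ₗ fdiffN η (prodLine D ι).s :=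
  idef_comp _ _ _ (mmulOp C') (fdiffN η' (prodLine D ι).s') (mmulOp C) (fdiffN η (prodLine D ι).s)

variable [Fintype X] [Fintype X'] {g : B6.Geometry} (blk : X → g.Site)
variable {F₁ F₃ : Type} [AddCommGroup F₁] [Module ℝ F₁] [AddCommGroup F₃] [Module ℝ F₃] {b₁ : BlockNorm g F₁} {b₃ : BlockNorm g F₃}

/-- **THE SANDWICHED FIRST-ORDER DEFECT FOR MATRIX COEFFICIENTS** (file 4's `hasMaj_comp_idef_firstOrder_comp` with `mulOp a` ↦ `mmulOp C`): on the
product carriers, `T′ ∘ 𝔇(M_{C′}∇′_{η′}, M_C∇_η) ∘ A` has the source-weighted majorant `(m₃A₁c_η + m_Tε A₁C)·e^{−ρd(y,y′)}·w(y′)` from: (d2) the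
adjoint-derivative entry of `T′∘M_{C′}` (`N₃`, `‖N₃‖_ρ ≤ m₃`; §3 supplies it from printed-shape letters), `T′` itself (`N_T`, `‖N_T‖_ρ ≤ m_T`), (d1) the
coarse derivative entry `∇_η∘A ≤ A₁e^{−(ρ+σ)d}`, (d3) the max-row-sum coefficient fit `o ≤ ε·w`, (d4) `|η′|(M − 1) ≤ c_η·w(y′)`.  Proof: Leibniz; the
derivative piece IS file 4's `hasMaj_derivPiece` on `X × ι` (product block-line data); the coefficient piece is §2. [folklore] -/
theorem hasMaj_comp_idef_firstOrderM_comp {η η' : ℝ} (hη' : η' ≠ 0) (hMη : (D.M : ℝ) * η' = η) (htri : Triangle254 g)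
    (hd : ∀ a b : g.Site, 0 ≤ g.dist a b) (hdiag : ∀ y, g.dist y y = 0) {ρ σ C ε A₁ m_T m₃ cη : ℝ} (hρ : 0 ≤ ρ)
    (hσ : 0 ≤ σ) (hA₁ : 0 ≤ A₁) (hC : 0 ≤ C) (hε : 0 ≤ ε) {w o : g.Site → ℝ} (hw : ∀ y, 0 ≤ w y) (hsw : SlowWeight g σ C w)
    (hηw : ∀ y', |η'| * ((D.M : ℝ) - 1) ≤ cη * w y') (ho : ∀ y, 0 ≤ o y) (how : ∀ y, o y ≤ ε * w y)
    {C' : X' → Matrix ι ι ℝ} {Cc : X → Matrix ι ι ℝ} (hfit : ∀ x' i, ∑ j, |C' x' i j - Cc (D.π x') i j| ≤ o (blk (D.π x')))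
    {T' : (X' × ι → ℝ) →ₗ[ℝ] F₃} {A : F₁ →ₗ[ℝ] (X × ι → ℝ)} {N_T N₃ : g.Site → g.Site → ℝ}
    (hNT : ∀ a b, 0 ≤ N_T a b) (hmT : WRow g ρ N_T m_T) (hT : HasMaj (BlockNorm.ofBlocks g (liftBlk (blk ∘ D.π) ι)) b₃ T' N_T)
    (hN₃ : ∀ a b, 0 ≤ N₃ a b) (hm₃ : WRow g ρ N₃ m₃)
    (hS : HasMaj (BlockNorm.ofBlocks g (liftBlk (blk ∘ D.π) ι)) b₃ ((T' ∘ₗ mmulOp C') ∘ₗ bdiffN η' (prodLine D ι).s') N₃)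
    (hA : HasMaj b₁ (BlockNorm.ofBlocks g (liftBlk blk ι)) (fdiffN η (prodLine D ι).s ∘ₗ A)
      (fun y y' => A₁ * Real.exp (-((ρ + σ) * g.dist y y')))) :
    HasMaj b₁ b₃ (T' ∘ₗ idef (pull (prodLine D ι).π) (pull (prodLine D ι).π)
        (mmulOp C' ∘ₗ fdiffN η' (prodLine D ι).s') (mmulOp Cc ∘ₗ fdiffN η (prodLine D ι).s) ∘ₗ A)
      (fun y y' => (m₃ * A₁ * cη + m_T * (ε * A₁ * C)) * Real.exp (-(ρ * g.dist y y')) * w y') := by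
  -- Leibniz and the sandwich identity
  have hop : T' ∘ₗ idef (pull (prodLine D ι).π) (pull (prodLine D ι).π)
        (mmulOp C' ∘ₗ fdiffN η' (prodLine D ι).s') (mmulOp Cc ∘ₗ fdiffN η (prodLine D ι).s) ∘ₗ A =
      (T' ∘ₗ mmulOp C') ∘ₗ idef (pull (prodLine D ι).π) (pull (prodLine D ι).π)
          (fdiffN η' (prodLine D ι).s') (fdiffN η (prodLine D ι).s) ∘ₗ A +
        T' ∘ₗ (idef (pull (prodLine D ι).π) (pull (prodLine D ι).π) (mmulOp C') (mmulOp Cc) ∘ₗ (fdiffN η (prodLine D ι).s ∘ₗ A)) := by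
    rw [idef_firstOrderM_eq]
    ext v
    simp only [LinearMap.comp_apply, LinearMap.add_apply, map_add]
  rw [hop]
  -- the derivative piece: file 4 on the product carrier
  have hAρ : HasMaj b₁ (BlockNorm.ofBlocks g (liftBlk blk ι)) (fdiffN η (prodLine D ι).s ∘ₗ A)
      (fun y y' => A₁ * Real.exp (-(ρ * g.dist y y'))) :=
    hA.mono fun y y' => mul_le_mul_of_nonneg_left (exp_rate_mono hσ (hd y y')) hA₁
  have h1 := hasMaj_derivPiece (prodLine D ι) (liftBlk blk ι) (b₁ := b₁) (b₃ := b₃) hη' hMη htri hρ hA₁ hN₃ hm₃ hS hAρ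
  -- the coefficient piece: §2
  have h2 : HasMaj b₁ b₃
      (T' ∘ₗ (idef (pull (prodLine D ι).π) (pull (prodLine D ι).π) (mmulOp C') (mmulOp Cc) ∘ₗ (fdiffN η (prodLine D ι).s ∘ₗ A)))
      (fun y y' => m_T * (ε * A₁ * C) * Real.exp (-(ρ * g.dist y y')) * w y') := by
    have hin : HasMaj b₁ (BlockNorm.ofBlocks g (liftBlk (blk ∘ D.π) ι))
        (idef (pull (prodLine D ι).π) (pull (prodLine D ι).π) (mmulOp C') (mmulOp Cc) ∘ₗ (fdiffN η (prodLine D ι).s ∘ₗ A))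
        (fun y y' => ε * A₁ * C * Real.exp (-(ρ * g.dist y y')) * w y') :=
      hasMaj_idef_mmulOp_comp_transfer (b₁ := b₁) (ι := ι) blk D.π htri hdiag hρ hA₁ hC hε hw hsw ho how hfit hA
    have key := hasMaj_comp_wrow_source htri hρ (mul_nonneg (mul_nonneg hε hA₁) hC) hNT hw hmT hT hin
    have hκ' : (BlockNorm.ofBlocks g (liftBlk (blk ∘ D.π) ι)).κ = 1 := rfl
    simpa only [hκ', one_mul] using key
  refine (h1.add h2).mono fun y y' => ?_
  have hm₃0 : 0 ≤ m₃ := hm₃.nonneg hN₃ y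
  have hE : 0 ≤ Real.exp (-(ρ * g.dist y y')) := Real.exp_nonneg _
  have hder : m₃ * (|η'| * (((prodLine D ι).M : ℝ) - 1) * A₁) * Real.exp (-(ρ * g.dist y y')) ≤
      m₃ * A₁ * cη * Real.exp (-(ρ * g.dist y y')) * w y' := by
    have := hηw y'
    rw [prodLine_M]
    calc m₃ * (|η'| * ((D.M : ℝ) - 1) * A₁) * Real.exp (-(ρ * g.dist y y'))
        = (m₃ * A₁ * Real.exp (-(ρ * g.dist y y'))) * (|η'| * ((D.M : ℝ) - 1)) := by ring
      _ ≤ (m₃ * A₁ * Real.exp (-(ρ * g.dist y y'))) * (cη * w y') :=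
          mul_le_mul_of_nonneg_left this (mul_nonneg (mul_nonneg hm₃0 hA₁) hE)
      _ = m₃ * A₁ * cη * Real.exp (-(ρ * g.dist y y')) * w y' := by ring
  calc m₃ * (|η'| * (((prodLine D ι).M : ℝ) - 1) * A₁) * Real.exp (-(ρ * g.dist y y')) +
        m_T * (ε * A₁ * C) * Real.exp (-(ρ * g.dist y y')) * w y'
      ≤ m₃ * A₁ * cη * Real.exp (-(ρ * g.dist y y')) * w y' +
        m_T * (ε * A₁ * C) * Real.exp (-(ρ * g.dist y y')) * w y' := add_le_add hder le_rfl
    _ = (m₃ * A₁ * cη + m_T * (ε * A₁ * C)) * Real.exp (-(ρ * g.dist y y')) * w y' := by ring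

end FirstOrder

end Summit.QuantumFields.YangMills.BalabanUVNodes.N15.MatrixSpecies
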